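import Summits.RiemannHypothesis.RiemannHypothesis.Theorems.SignConeConeMagnificationCombInequalityDesign
import Summits.RiemannHypothesis.RiemannHypothesis.Theorems.SignConeConeMagnificationCombTypePairData
import Summits.RiemannHypothesis.RiemannHypothesis.Theorems.SignConeConeMagnificationDesignClasses
import Literature.NumberTheory.LFunctions.ClassSumsConverge
import Literature.NumberTheory.LFunctions.TypeLimitsExist

/-!
# Crux `SignCone.ConeMagnification` (stmt-RiemannHypothesis-16303), line `Sketch` r9, stub `stub_combType` — assembly, part 2b′:
# the type inequality `T(β) ≤ ½ Re Φ_β(1)` from the comb inequality and PAIR-LEVEL data (second interface)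

Variant of `CombType.typeBound_of_nodeData` (`…CombTypeAssembly`) in which the node-level decomposition hypothesis is replaced by the
PAIR-LEVEL hypothesis `hpairD`: eventually in `M`, for every pair `ℓ, ℓ' ≤ L` there is a class term `S` (`|S| ≤ C(log M)^θ`) with
`|(E_c − E_Λ)(ℓ,ℓ') − Σ_{n ≤ 3LM} (c−Λ)(n)·(B₀√(ℓ/ℓ')·(Σ_{k' ≤ ⌊X_M/(nℓ')⌋}[ℓ ∣ nℓ'k']/k')/n + S(gcd(nℓ',ℓ))/n)| ≤ C(log M)^θ`
(`E_f(ℓ,ℓ') = Σ_{n ≤ 3LM} f(n) V_M(ℓ,ℓ',n)`, `X_M = M/(4√(log M))`) and `|V_M(ℓ,ℓ',1) − B₀(gcd(ℓ',ℓ)/√(ℓℓ')) log M| ≤ C(log M)^θ`,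
for some `C` and `θ < 1` — the shape produced by `pair_difference_bound`-type lemmas
(`Literature/NumberTheory/LFunctions/WeilCombPairDifference.lean`) once their error is `o(log M)`.  The proof is that of
`typeBound_of_nodeData` with `CombType.pair_bound_of_pairData` in place of `CombType.pair_bound`.

`typeBound_of_pairData`: conclusion — the limit `T` of the type partial sums of the real design `β` satisfies `T ≤ ½ Re Φ_β(1)`.
-/

noncomputable section

-- `Summit.RiemannHypothesis.RiemannHypothesis.…` repeats a namespace component by design (D-0017 layout).
set_option linter.dupNamespace false

open scoped BigOperators ComplexConjugate Topology ArithmeticFunction.vonMangoldt ContDiff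
open Complex MeasureTheory Set Filter

namespace Summit.RiemannHypothesis.RiemannHypothesis.Theorems.SignConeConeMagnification

open Literature.NumberTheory.LFunctions
open Literature.NumberTheory.LFunctions.GcdForm (gcdForm)

namespace CombType

/-! ### The abstract assembly theorem -/

/-- **Type inequality from the comb inequality and sharp node data** (seat-0's assembly of `stub_combType`; the node
data are the lead's wave-3 Literature lemmas).  See the module docstring for the shape of the hypotheses. [folklore] -/
theorem typeBound_of_pairData (c : ℕ → ℝ) (hc0 : ∀ n, 0 ≤ c n)
    (hU : ∀ g : ℝ → ℂ, IsWeilTest g →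
      -(∫ t, ‖g t‖ ^ 2) ≤
        (weilPolarTerm (weilConv g (weilReflect g)) + weilArchTerm (weilConv g (weilReflect g)) -
          ∑' n : ℕ, ((c n : ℝ) : ℂ) / (Real.sqrt n : ℂ) *
            (weilConv g (weilReflect g) (Real.log n) + weilConv g (weilReflect g) (-Real.log n))).re)
    (hLoc : ∀ p : ℕ, p.Prime → Summable (fun n : ℕ => if p ∣ n then c n / n else 0))
    {C₁ : ℝ} (hC₁ : Tendsto (fun N : ℕ => ∑ n ∈ Finset.range N, (c n - Λ n) / n) atTop (𝓝 C₁))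
    {β : ℕ → ℝ} {L : ℕ} (hβ : ∀ m, L < m → β m = 0) (hL : 1 ≤ L)
    {b : ℝ → ℝ} (hb : ContDiff ℝ ∞ b) (hbc : HasCompactSupport b) (hbs : tsupport b ⊆ Icc (-1) 1)
    {B₀ : ℝ} (hB₀ : 0 < B₀)
    (V : ℕ → ℕ → ℕ → ℕ → ℝ)
    (hV : ∀ M ℓ ℓ' n : ℕ, V M ℓ ℓ' n = ∑ k' ∈ Finset.Icc 1 M,
      (∑ k ∈ Finset.Icc 1 M, (∫ u, b u * b (u - (Real.log ((n : ℝ) * ℓ' * k' / ℓ) - Real.log k)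
          / (Real.sqrt (Real.log M) / M))) / Real.sqrt k) / Real.sqrt k' / Real.sqrt n)
    {Cst θ : ℝ} (hθ : θ < 1)
    (hpairD : ∀ᶠ M : ℕ in atTop, ∀ ℓ ∈ Finset.Icc 1 L, ∀ ℓ' ∈ Finset.Icc 1 L,
      ∃ S : ℕ → ℝ,
        (∀ δ, |S δ| ≤ Cst * Real.log M ^ θ) ∧
        (|((∑ n ∈ Finset.Icc 1 (3 * L * M), c n * V M ℓ ℓ' n) - ∑ n ∈ Finset.Icc 1 (3 * L * M), (Λ n : ℝ) * V M ℓ ℓ' n) -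
          ∑ n ∈ Finset.Icc 1 (3 * L * M), (c n - Λ n) *
            (B₀ * (Real.sqrt ℓ / Real.sqrt ℓ') *
                (∑ k' ∈ Finset.Icc 1 (⌊(M : ℝ) / (4 * Real.sqrt (Real.log M)) / ((n : ℝ) * ℓ')⌋₊),
                  (if ℓ ∣ n * ℓ' * k' then (1 : ℝ) / k' else 0)) / n +
              S (Nat.gcd (n * ℓ') ℓ) / n)| ≤ Cst * Real.log M ^ θ) ∧
        (|V M ℓ ℓ' 1 - B₀ * ((Nat.gcd ℓ' ℓ : ℝ) / Real.sqrt ((ℓ : ℝ) * ℓ')) * Real.log M| ≤ Cst * Real.log M ^ θ))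
    {T : ℝ} (hT : Tendsto (fun N : ℕ => ∑ n ∈ Finset.range N,
      (c n - Λ n) / n * (gcdForm (fun m => ((β m : ℝ) : ℂ)) L n).re) atTop (𝓝 T)) :
    T ≤ 1 / 2 * (gcdForm (fun m => ((β m : ℝ) : ℂ)) L 1).re := by
  classical
  -- notation
  set d : ℕ → ℝ := fun n => (c n - Λ n) / n with hd
  set coef : ℕ → ℕ → ℕ → ℝ := fun ℓ ℓ' δ => β ℓ * β ℓ' * δ / Real.sqrt ((ℓ : ℝ) * ℓ') with hcoef
  set ind : ℕ → ℕ → ℕ → ℕ → ℝ := fun ℓ ℓ' δ n => if Nat.gcd (n * ℓ') ℓ = δ then (1 : ℝ) else 0 with hind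
  -- class limits
  have hcls : ∀ ℓ ℓ' δ : ℕ, ∃ Tc : ℝ, ℓ ∈ Finset.Icc 1 L →
      Tendsto (fun N : ℕ => ∑ n ∈ Finset.range N, d n * ind ℓ ℓ' δ n) atTop (𝓝 Tc) := by
    intro ℓ ℓ' δ
    by_cases hℓ : ℓ ∈ Finset.Icc 1 L
    · obtain ⟨Tc, hTc⟩ := TypeDesign.gcdClassSum_converges hc0 hLoc hC₁ hℓ ℓ' δ
      exact ⟨Tc, fun _ => by simpa only [hd, hind] using hTc⟩
    · exact ⟨0, fun h => (hℓ h).elim⟩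
  choose Tc hTc using hcls
  -- `T = Σ coef · Tc`
  have hTsum : T = ∑ ℓ ∈ Finset.Icc 1 L, ∑ ℓ' ∈ Finset.Icc 1 L, ∑ δ ∈ ℓ.divisors, coef ℓ ℓ' δ * Tc ℓ ℓ' δ := by
    have h2 : Tendsto (fun N : ℕ => ∑ n ∈ Finset.range N, d n * (gcdForm (fun m => ((β m : ℝ) : ℂ)) L n).re) atTop
        (𝓝 (∑ ℓ ∈ Finset.Icc 1 L, ∑ ℓ' ∈ Finset.Icc 1 L, ∑ δ ∈ ℓ.divisors, coef ℓ ℓ' δ * Tc ℓ ℓ' δ)) := by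
      have h3 : Tendsto (fun N : ℕ => ∑ ℓ ∈ Finset.Icc 1 L, ∑ ℓ' ∈ Finset.Icc 1 L, ∑ δ ∈ ℓ.divisors,
          coef ℓ ℓ' δ * ∑ n ∈ Finset.range N, d n * ind ℓ ℓ' δ n) atTop
          (𝓝 (∑ ℓ ∈ Finset.Icc 1 L, ∑ ℓ' ∈ Finset.Icc 1 L, ∑ δ ∈ ℓ.divisors, coef ℓ ℓ' δ * Tc ℓ ℓ' δ)) :=
        tendsto_finsetSum _ fun ℓ hℓ => tendsto_finsetSum _ fun ℓ' _ => tendsto_finsetSum _ fun δ _ =>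
          (hTc ℓ ℓ' δ hℓ).const_mul _
      refine h3.congr fun N => ?_
      rw [TypeDesign.sum_mul_re_gcdForm_eq_sum_gcdClasses]
      refine Finset.sum_congr rfl fun ℓ _ => Finset.sum_congr rfl fun ℓ' _ => Finset.sum_congr rfl fun δ _ => ?_
      rw [re_coef_ofReal, Finset.mul_sum]
    exact tendsto_nhds_unique hT h2
  rw [hTsum, re_gcdForm_one_ofReal]
  -- it suffices to prove the bound with `(1+ε)/2` and `+ ε`
  set Φ1 : ℝ := ∑ ℓ ∈ Finset.Icc 1 L, ∑ ℓ' ∈ Finset.Icc 1 L, β ℓ * β ℓ' * (Nat.gcd ℓ' ℓ : ℝ) / Real.sqrt ((ℓ : ℝ) * ℓ')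
    with hΦ1
  suffices hmain : ∀ ε : ℝ, 0 < ε →
      ∑ ℓ ∈ Finset.Icc 1 L, ∑ ℓ' ∈ Finset.Icc 1 L, ∑ δ ∈ ℓ.divisors, coef ℓ ℓ' δ * Tc ℓ ℓ' δ ≤ (1 + ε) / 2 * Φ1 + ε by
    refine le_of_forall_pos_le_add fun ε hε => ?_
    have hε' : 0 < ε / (|Φ1| / 2 + 1) := div_pos hε (by positivity)
    have h := hmain _ hε'
    have hb : (1 + ε / (|Φ1| / 2 + 1)) / 2 * Φ1 + ε / (|Φ1| / 2 + 1) ≤ 1 / 2 * Φ1 + ε := by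
      have hpos : 0 < |Φ1| / 2 + 1 := by positivity
      rw [show (1 + ε / (|Φ1| / 2 + 1)) / 2 * Φ1 + ε / (|Φ1| / 2 + 1) =
        1 / 2 * Φ1 + ε / (|Φ1| / 2 + 1) * (Φ1 / 2 + 1) by ring]
      have h1 : Φ1 / 2 + 1 ≤ |Φ1| / 2 + 1 := by linarith [le_abs_self Φ1]
      have h2 : ε / (|Φ1| / 2 + 1) * (Φ1 / 2 + 1) ≤ ε / (|Φ1| / 2 + 1) * (|Φ1| / 2 + 1) :=
        mul_le_mul_of_nonneg_left h1 hε'.le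
      rw [div_mul_cancel₀ _ hpos.ne'] at h2
      linarith
    exact h.trans hb
  intro ε hε
  -- the weighted class sums `Q_M` and their limit
  set X : ℕ → ℝ := fun M => (M : ℝ) / (4 * Real.sqrt (Real.log M)) with hX
  set w : ℕ → ℕ → ℕ → ℕ → ℕ → ℝ := fun ℓ ℓ' δ M n =>
    (∑ j ∈ Finset.Icc 1 (⌊X M / ((max n 1 : ℕ) * ℓ')⌋₊ / (ℓ / δ)), (1 : ℝ) / j) / Real.log M with hw
  have hQlim : Tendsto (fun M : ℕ => ∑ ℓ ∈ Finset.Icc 1 L, ∑ ℓ' ∈ Finset.Icc 1 L, ∑ δ ∈ ℓ.divisors,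
      coef ℓ ℓ' δ * ∑ n ∈ Finset.range (3 * L * M + 1), d n * ind ℓ ℓ' δ n * w ℓ ℓ' δ M n) atTop
      (𝓝 (∑ ℓ ∈ Finset.Icc 1 L, ∑ ℓ' ∈ Finset.Icc 1 L, ∑ δ ∈ ℓ.divisors, coef ℓ ℓ' δ * Tc ℓ ℓ' δ)) := by
    refine tendsto_finsetSum _ fun ℓ hℓ => tendsto_finsetSum _ fun ℓ' hℓ' => tendsto_finsetSum _ fun δ hδ => ?_
    refine ((TypeDesign.tendsto_sum_mul_weight_of_tendsto (hTc ℓ ℓ' δ hℓ) (w ℓ ℓ' δ) (fun M => 3 * L * M + 1)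
      ?_ ?_ ?_ ?_).const_mul _)
    · -- antitone
      filter_upwards [eventually_ge_atTop 1] with M hM
      have hXM : 0 ≤ X M := by simp only [hX]; positivity
      have hlog : 0 ≤ Real.log M := Real.log_natCast_nonneg M
      intro n m hnm
      simp only [hw]
      exact div_le_div_of_nonneg_right (harmWeight_antitone hXM (ℓ / δ) (Finset.mem_Icc.1 hℓ').1 hnm) hlog
    · -- nonneg
      filter_upwards [eventually_ge_atTop 1] with M hM n
      simp only [hw]
      exact div_nonneg (harmWeight_nonneg _ _ _ _) (Real.log_natCast_nonneg M)
    · -- zero beyond `3LM+1`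
      filter_upwards [eventually_ge_atTop 2] with M hM n hn
      simp only [hw]
      have hℓ'1 := (Finset.mem_Icc.1 hℓ').1
      have hn1 : 1 ≤ n := le_trans (by omega) hn
      have hXlt : X M < n * ℓ' := by
        -- `X M < M ≤ 3LM + 1 ≤ n ≤ n ℓ'`
        have hM2 : (2 : ℝ) ≤ M := by exact_mod_cast hM
        have hl2 : (1 / 2 : ℝ) < Real.log 2 := by linarith [Real.log_two_gt_d9]
        have hsq : 1 / 2 < Real.sqrt (Real.log M) := by
          have : Real.sqrt (1 / 4) = 1 / 2 := by
            rw [show (1 / 4 : ℝ) = (1 / 2) ^ 2 by norm_num, Real.sqrt_sq (by norm_num)]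
          rw [← this]
          exact Real.sqrt_lt_sqrt (by norm_num) (by linarith [Real.log_le_log two_pos hM2])
        have h1 : X M < M := by
          simp only [hX]
          rw [div_lt_iff₀ (by positivity)]
          nlinarith
        have h2 : (M : ℝ) ≤ n := by
          have : M ≤ n := le_trans (by nlinarith) hn
          exact_mod_cast this
        have h3 : (n : ℝ) ≤ n * ℓ' := by
          have : (1 : ℝ) ≤ ℓ' := by exact_mod_cast hℓ'1
          have hn0 : (0 : ℝ) ≤ n := Nat.cast_nonneg n
          nlinarith
        linarith
      rw [harmWeight_eq_zero (ℓ / δ) ℓ' hn1 hXlt, zero_div]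
    · -- tends to one
      intro n
      have hq : 1 ≤ ℓ / δ := Nat.div_pos (Nat.le_of_dvd (Finset.mem_Icc.1 hℓ).1 (Nat.dvd_of_mem_divisors hδ))
        (Nat.pos_of_mem_divisors hδ)
      simpa only [hw, hX] using tendsto_harmWeight_div_log hq (Finset.mem_Icc.1 hℓ').1 n
  -- the eventual bound `Q_M ≤ (1+ε)/2 Φ1 + ε`
  refine le_of_tendsto hQlim ?_
  -- class partial sums are bounded
  have hbdd : ∀ ℓ ℓ' δ : ℕ, ∃ K : ℝ, 0 ≤ K ∧ (ℓ ∈ Finset.Icc 1 L → ∀ N, |∑ n ∈ Finset.range N, d n * ind ℓ ℓ' δ n| ≤ K) := by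
    intro ℓ ℓ' δ
    by_cases hℓ : ℓ ∈ Finset.Icc 1 L
    · obtain ⟨C, hC⟩ := isBounded_iff_forall_norm_le.1 (Metric.isBounded_range_of_tendsto _ (hTc ℓ ℓ' δ hℓ))
      refine ⟨max C 0, le_max_right _ _, fun _ N => ?_⟩
      have := hC _ ⟨N, rfl⟩
      rw [Real.norm_eq_abs] at this
      exact this.trans (le_max_left _ _)
    · exact ⟨0, le_rfl, fun h => (hℓ h).elim⟩
  choose K hK0 hK using hbdd
  -- comb inequality with this `ε`
  obtain ⟨M₁, hM₁⟩ := comb_inequality_design c hU hβ hL hb hbc hbs hε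
  -- the error budget tends to `0` after division by `B₀ log M`
  set Ctot : ℝ := ∑ ℓ ∈ Finset.Icc 1 L, ∑ ℓ' ∈ Finset.Icc 1 L, |β ℓ * β ℓ'| *
      ((1 + ε) / 2 * Cst + (Cst * (∑ δ ∈ ℓ.divisors, K ℓ ℓ' δ) + Cst + Cst)) with hCtot
  have herr : Tendsto (fun M : ℕ => Ctot * Real.log M ^ θ / (B₀ * Real.log M)) atTop (𝓝 0) := by
    -- `(log M)^θ / log M = (log M)^(θ-1) → 0`
    have h1 : Tendsto (fun M : ℕ => Real.log M ^ (θ - 1)) atTop (𝓝 0) := by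
      have := (tendsto_rpow_neg_atTop (by linarith : 0 < 1 - θ)).comp
        (Real.tendsto_log_atTop.comp tendsto_natCast_atTop_atTop)
      refine this.congr fun M => ?_
      simp only [Function.comp_apply]
      rw [show -(1 - θ) = θ - 1 by ring]
    have h2 := h1.const_mul (Ctot / B₀)
    rw [mul_zero] at h2
    refine h2.congr' ?_
    filter_upwards [eventually_ge_atTop 2] with M hM
    have hlog : 0 < Real.log M := Real.log_pos (by exact_mod_cast (by omega : 1 < M))
    rw [Real.rpow_sub hlog, Real.rpow_one]
    field_simp
  have hsmall := herr.eventually (gt_mem_nhds hε)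
  filter_upwards [hpairD, eventually_ge_atTop M₁, eventually_ge_atTop 2, hsmall] with M hnodeM hMM₁ hM2 hsmallM
  have hlog : 0 < Real.log M := Real.log_pos (by exact_mod_cast (by omega : 1 < M))
  have hlogθ : 0 ≤ Real.log M ^ θ := Real.rpow_nonneg hlog.le θ
  -- the comb inequality at `M`
  have hCI := hM₁ M hMM₁
  -- per-pair evaluation: `|D − A| ≤ E` (`pair_bound`)
  have hpair : ∀ ℓ ∈ Finset.Icc 1 L, ∀ ℓ' ∈ Finset.Icc 1 L,
      |((∑ n ∈ Finset.Icc 1 (3 * L * M), c n * V M ℓ ℓ' n) - ∑ n ∈ Finset.Icc 1 (3 * L * M), (Λ n : ℝ) * V M ℓ ℓ' n) -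
        B₀ * Real.log M * (∑ δ ∈ ℓ.divisors, (δ : ℝ) / Real.sqrt ((ℓ : ℝ) * ℓ') *
          ∑ n ∈ Finset.range (3 * L * M + 1), d n * ind ℓ ℓ' δ n * w ℓ ℓ' δ M n)| ≤
        (Cst * (∑ δ ∈ ℓ.divisors, K ℓ ℓ' δ) + Cst + Cst) * Real.log M ^ θ := by
    intro ℓ hℓ ℓ' hℓ'
    obtain ⟨S, hS, hpd, -⟩ := hnodeM ℓ hℓ ℓ' hℓ'
    have := pair_bound_of_pairData hℓ hℓ' hlog V S hS hpd (K ℓ ℓ') (fun δ N => hK ℓ ℓ' δ hℓ N)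
    simpa only [hd, hind, hw, hX] using this

  -- the norm side
  have hnorm : ∀ ℓ ∈ Finset.Icc 1 L, ∀ ℓ' ∈ Finset.Icc 1 L,
      |V M ℓ ℓ' 1 - B₀ * ((Nat.gcd ℓ' ℓ : ℝ) / Real.sqrt ((ℓ : ℝ) * ℓ')) * Real.log M| ≤ Cst * Real.log M ^ θ := by
    intro ℓ hℓ ℓ' hℓ'
    obtain ⟨-, -, -, h⟩ := hnodeM ℓ hℓ ℓ' hℓ'
    exact h
  -- rewrite the comb inequality in terms of `V`
  have hCI' : (∑ ℓ ∈ Finset.Icc 1 L, ∑ ℓ' ∈ Finset.Icc 1 L, β ℓ * β ℓ' *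
        ((∑ n ∈ Finset.Icc 1 (3 * L * M), c n * V M ℓ ℓ' n) -
          ∑ n ∈ Finset.Icc 1 (3 * L * M), (Λ n : ℝ) * V M ℓ ℓ' n)) ≤
      (1 + ε) / 2 * ∑ ℓ ∈ Finset.Icc 1 L, ∑ ℓ' ∈ Finset.Icc 1 L, β ℓ * β ℓ' * V M ℓ ℓ' 1 := by
    have h := hCI
    simp only [← hV] at h
    rw [← Finset.sum_sub_distrib] at h
    refine le_trans (le_of_eq ?_) h
    refine Finset.sum_congr rfl fun ℓ _ => ?_
    rw [← Finset.sum_sub_distrib]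
    refine Finset.sum_congr rfl fun ℓ' _ => ?_
    ring
  -- an elementary inequality: `x·A ≤ x·D + |x|·E` when `|D − A| ≤ E`
  have hxAD : ∀ x A D E : ℝ, |D - A| ≤ E → x * A ≤ x * D + |x| * E := by
    intro x A D E h
    have h1 : x * A - x * D = x * (A - D) := by ring
    have h2 : |x * (A - D)| ≤ |x| * E := by
      rw [abs_mul, abs_sub_comm]
      exact mul_le_mul_of_nonneg_left h (abs_nonneg x)
    linarith [le_abs_self (x * (A - D))]
  -- assemble: `B₀ log M · Q_M ≤ (1+ε)/2 · B₀ log M · Φ1 + Ctot (log M)^θ`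
  have hQ : B₀ * Real.log M * (∑ ℓ ∈ Finset.Icc 1 L, ∑ ℓ' ∈ Finset.Icc 1 L, ∑ δ ∈ ℓ.divisors,
      coef ℓ ℓ' δ * ∑ n ∈ Finset.range (3 * L * M + 1), d n * ind ℓ ℓ' δ n * w ℓ ℓ' δ M n) ≤
      (1 + ε) / 2 * (B₀ * Real.log M * Φ1) + Ctot * Real.log M ^ θ := by
    -- LHS as `Σ x · A`
    have hLHS : B₀ * Real.log M * (∑ ℓ ∈ Finset.Icc 1 L, ∑ ℓ' ∈ Finset.Icc 1 L, ∑ δ ∈ ℓ.divisors,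
        coef ℓ ℓ' δ * ∑ n ∈ Finset.range (3 * L * M + 1), d n * ind ℓ ℓ' δ n * w ℓ ℓ' δ M n) =
        ∑ ℓ ∈ Finset.Icc 1 L, ∑ ℓ' ∈ Finset.Icc 1 L, β ℓ * β ℓ' *
          (B₀ * Real.log M * (∑ δ ∈ ℓ.divisors, (δ : ℝ) / Real.sqrt ((ℓ : ℝ) * ℓ') *
            ∑ n ∈ Finset.range (3 * L * M + 1), d n * ind ℓ ℓ' δ n * w ℓ ℓ' δ M n)) := by
      rw [Finset.mul_sum]
      refine Finset.sum_congr rfl fun ℓ _ => ?_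
      rw [Finset.mul_sum]
      refine Finset.sum_congr rfl fun ℓ' _ => ?_
      rw [Finset.mul_sum, Finset.mul_sum, Finset.mul_sum]
      refine Finset.sum_congr rfl fun δ _ => ?_
      simp only [hcoef]
      ring
    -- step 1: replace `A` by `D` pairwise
    have hstep1 : ∑ ℓ ∈ Finset.Icc 1 L, ∑ ℓ' ∈ Finset.Icc 1 L, β ℓ * β ℓ' *
          (B₀ * Real.log M * (∑ δ ∈ ℓ.divisors, (δ : ℝ) / Real.sqrt ((ℓ : ℝ) * ℓ') *
            ∑ n ∈ Finset.range (3 * L * M + 1), d n * ind ℓ ℓ' δ n * w ℓ ℓ' δ M n)) ≤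
        ∑ ℓ ∈ Finset.Icc 1 L, ∑ ℓ' ∈ Finset.Icc 1 L, (β ℓ * β ℓ' *
          ((∑ n ∈ Finset.Icc 1 (3 * L * M), c n * V M ℓ ℓ' n) -
            ∑ n ∈ Finset.Icc 1 (3 * L * M), (Λ n : ℝ) * V M ℓ ℓ' n) +
          |β ℓ * β ℓ'| * ((Cst * (∑ δ ∈ ℓ.divisors, K ℓ ℓ' δ) + Cst + Cst) * Real.log M ^ θ)) :=
      Finset.sum_le_sum fun ℓ hℓ => Finset.sum_le_sum fun ℓ' hℓ' => hxAD _ _ _ _ (hpair ℓ hℓ ℓ' hℓ')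
    -- step 2: the norm side pairwise
    have hstep2 : ∑ ℓ ∈ Finset.Icc 1 L, ∑ ℓ' ∈ Finset.Icc 1 L, β ℓ * β ℓ' * V M ℓ ℓ' 1 ≤
        ∑ ℓ ∈ Finset.Icc 1 L, ∑ ℓ' ∈ Finset.Icc 1 L, (β ℓ * β ℓ' *
          (B₀ * ((Nat.gcd ℓ' ℓ : ℝ) / Real.sqrt ((ℓ : ℝ) * ℓ')) * Real.log M) + |β ℓ * β ℓ'| * (Cst * Real.log M ^ θ)) := by
      refine Finset.sum_le_sum fun ℓ hℓ => Finset.sum_le_sum fun ℓ' hℓ' => ?_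
      have h := hnorm ℓ hℓ ℓ' hℓ'
      -- `x·V ≤ x·main + |x|·Cst logθ` from `|V − main| ≤ Cst logθ`
      have := hxAD (β ℓ * β ℓ') (V M ℓ ℓ' 1) (B₀ * ((Nat.gcd ℓ' ℓ : ℝ) / Real.sqrt ((ℓ : ℝ) * ℓ')) * Real.log M)
        (Cst * Real.log M ^ θ) (by rwa [abs_sub_comm] at h)
      linarith
    have hε2 : 0 ≤ (1 + ε) / 2 := by linarith
    have hstep2' := mul_le_mul_of_nonneg_left hstep2 hε2
    -- algebra
    have hsplit1 : ∑ ℓ ∈ Finset.Icc 1 L, ∑ ℓ' ∈ Finset.Icc 1 L, (β ℓ * β ℓ' *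
          ((∑ n ∈ Finset.Icc 1 (3 * L * M), c n * V M ℓ ℓ' n) -
            ∑ n ∈ Finset.Icc 1 (3 * L * M), (Λ n : ℝ) * V M ℓ ℓ' n) +
          |β ℓ * β ℓ'| * ((Cst * (∑ δ ∈ ℓ.divisors, K ℓ ℓ' δ) + Cst + Cst) * Real.log M ^ θ)) =
        (∑ ℓ ∈ Finset.Icc 1 L, ∑ ℓ' ∈ Finset.Icc 1 L, β ℓ * β ℓ' *
          ((∑ n ∈ Finset.Icc 1 (3 * L * M), c n * V M ℓ ℓ' n) -
            ∑ n ∈ Finset.Icc 1 (3 * L * M), (Λ n : ℝ) * V M ℓ ℓ' n)) +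
        ∑ ℓ ∈ Finset.Icc 1 L, ∑ ℓ' ∈ Finset.Icc 1 L,
          |β ℓ * β ℓ'| * ((Cst * (∑ δ ∈ ℓ.divisors, K ℓ ℓ' δ) + Cst + Cst) * Real.log M ^ θ) := by
      rw [← Finset.sum_add_distrib]
      exact Finset.sum_congr rfl fun ℓ _ => Finset.sum_add_distrib
    have hsplit2 : ∑ ℓ ∈ Finset.Icc 1 L, ∑ ℓ' ∈ Finset.Icc 1 L, (β ℓ * β ℓ' *
          (B₀ * ((Nat.gcd ℓ' ℓ : ℝ) / Real.sqrt ((ℓ : ℝ) * ℓ')) * Real.log M) + |β ℓ * β ℓ'| * (Cst * Real.log M ^ θ)) =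
        B₀ * Real.log M * Φ1 +
          ∑ ℓ ∈ Finset.Icc 1 L, ∑ ℓ' ∈ Finset.Icc 1 L, |β ℓ * β ℓ'| * (Cst * Real.log M ^ θ) := by
      rw [hΦ1, Finset.mul_sum, ← Finset.sum_add_distrib]
      refine Finset.sum_congr rfl fun ℓ _ => ?_
      rw [Finset.mul_sum, ← Finset.sum_add_distrib]
      refine Finset.sum_congr rfl fun ℓ' _ => ?_
      ring
    have hCtot' : (1 + ε) / 2 * ∑ ℓ ∈ Finset.Icc 1 L, ∑ ℓ' ∈ Finset.Icc 1 L, |β ℓ * β ℓ'| * (Cst * Real.log M ^ θ) +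
        ∑ ℓ ∈ Finset.Icc 1 L, ∑ ℓ' ∈ Finset.Icc 1 L,
          |β ℓ * β ℓ'| * ((Cst * (∑ δ ∈ ℓ.divisors, K ℓ ℓ' δ) + Cst + Cst) * Real.log M ^ θ) =
        Ctot * Real.log M ^ θ := by
      simp only [hCtot, Finset.sum_mul, Finset.mul_sum]
      rw [← Finset.sum_add_distrib]
      refine Finset.sum_congr rfl fun ℓ _ => ?_
      rw [← Finset.sum_add_distrib]
      refine Finset.sum_congr rfl fun ℓ' _ => ?_
      ring
    rw [hLHS]
    calc _ ≤ _ := hstep1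
      _ = _ := hsplit1
      _ ≤ (1 + ε) / 2 * ∑ ℓ ∈ Finset.Icc 1 L, ∑ ℓ' ∈ Finset.Icc 1 L, β ℓ * β ℓ' * V M ℓ ℓ' 1 +
            ∑ ℓ ∈ Finset.Icc 1 L, ∑ ℓ' ∈ Finset.Icc 1 L,
              |β ℓ * β ℓ'| * ((Cst * (∑ δ ∈ ℓ.divisors, K ℓ ℓ' δ) + Cst + Cst) * Real.log M ^ θ) :=
          add_le_add hCI' le_rfl
      _ ≤ (1 + ε) / 2 * (B₀ * Real.log M * Φ1 +
            ∑ ℓ ∈ Finset.Icc 1 L, ∑ ℓ' ∈ Finset.Icc 1 L, |β ℓ * β ℓ'| * (Cst * Real.log M ^ θ)) +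
            ∑ ℓ ∈ Finset.Icc 1 L, ∑ ℓ' ∈ Finset.Icc 1 L,
              |β ℓ * β ℓ'| * ((Cst * (∑ δ ∈ ℓ.divisors, K ℓ ℓ' δ) + Cst + Cst) * Real.log M ^ θ) := by
          rw [← hsplit2]
          exact add_le_add hstep2' le_rfl
      _ = (1 + ε) / 2 * (B₀ * Real.log M * Φ1) + Ctot * Real.log M ^ θ := by
          rw [← hCtot']
          ring
  -- divide by `B₀ log M`
  have hBlog : 0 < B₀ * Real.log M := mul_pos hB₀ hlog
  have hfinal : (∑ ℓ ∈ Finset.Icc 1 L, ∑ ℓ' ∈ Finset.Icc 1 L, ∑ δ ∈ ℓ.divisors,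
      coef ℓ ℓ' δ * ∑ n ∈ Finset.range (3 * L * M + 1), d n * ind ℓ ℓ' δ n * w ℓ ℓ' δ M n) ≤
      (1 + ε) / 2 * Φ1 + Ctot * Real.log M ^ θ / (B₀ * Real.log M) := by
    have key : B₀ * Real.log M * ((1 + ε) / 2 * Φ1 + Ctot * Real.log M ^ θ / (B₀ * Real.log M)) =
        (1 + ε) / 2 * (B₀ * Real.log M * Φ1) + Ctot * Real.log M ^ θ := by
      field_simp
    refine le_of_mul_le_mul_left ?_ hBlog
    rw [key]
    exact hQ
  linarith [hfinal, hsmallM]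

/-- **Anchor `combTypeBoundOfPairData`** (registered sub-goal; `typeBound_of_pairData` with explicit quantifiers and names): the type
inequality for a real design from the comb inequality and PAIR-LEVEL sharp data. [folklore] -/
theorem combTypeBoundOfPairData : ∀ c : ℕ → ℝ, (∀ n, 0 ≤ c n) → (∀ g : ℝ → ℂ, IsWeilTest g → -(∫ t, ‖g t‖ ^ 2) ≤ (weilPolarTerm (weilConv g (weilReflect g)) + weilArchTerm (weilConv g (weilReflect g)) - ∑' n : ℕ, ((c n : ℝ) : ℂ) / (Real.sqrt n : ℂ) * (weilConv g (weilReflect g) (Real.log n) + weilConv g (weilReflect g) (-Real.log n))).re) → (∀ p : ℕ, p.Prime → Summable (fun n : ℕ => if p ∣ n then c n / n else 0)) → ∀ C₁ : ℝ, (Filter.Tendsto (fun N : ℕ => ∑ n ∈ Finset.range N, (c n - ArithmeticFunction.vonMangoldt n) / n) Filter.atTop (nhds C₁)) → ∀ β : ℕ → ℝ, ∀ L : ℕ, (∀ m, L < m → β m = 0) → (1 ≤ L) → ∀ b : ℝ → ℝ, (ContDiff ℝ (⊤ : ℕ∞) b) → (HasCompactSupport b) → (tsupport b ⊆ Set.Icc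 (-1) 1) → ∀ B₀ : ℝ, (0 < B₀) → ∀ V : ℕ → ℕ → ℕ → ℕ → ℝ, (∀ M ℓ ℓ' n : ℕ, V M ℓ ℓ' n = ∑ k' ∈ Finset.Icc 1 M, (∑ k ∈ Finset.Icc 1 M, (∫ u, b u * b (u - (Real.log ((n : ℝ) * ℓ' * k' / ℓ) - Real.log k) / (Real.sqrt (Real.log M) / M))) / Real.sqrt k) / Real.sqrt k' / Real.sqrt n) → ∀ Cst θ : ℝ, (θ < 1) → (∀ᶠ M : ℕ in Filter.atTop, ∀ ℓ ∈ Finset.Icc 1 L, ∀ ℓ' ∈ Finset.Icc 1 L, ∃ S : ℕ → ℝ, (∀ δ, |S δ| ≤ Cst * Real.log M ^ θ) ∧ (|((∑ n ∈ Finset.Icc 1 (3 * L * M), c n * V M ℓ ℓ' n) - ∑ n ∈ Finset.Icc 1 (3 * L * M), (ArithmeticFunction.vonMangoldt n : ℝ) * V M ℓ ℓ' n) - ∑ n ∈ Finset.Icc 1 (3 * L * M), (c n - ArithmeticFunction.vonMangoldt n) * (B₀ * (Real.sqrt ℓ / Real.sqrt ℓ') * (∑ k' ∈ Finset.Icc 1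 (⌊(M : ℝ) / (4 * Real.sqrt (Real.log M)) / ((n : ℝ) * ℓ')⌋₊), (if ℓ ∣ n * ℓ' * k' then (1 : ℝ) / k' else 0)) / n + S (Nat.gcd (n * ℓ') ℓ) / n)| ≤ Cst * Real.log M ^ θ) ∧ (|V M ℓ ℓ' 1 - B₀ * ((Nat.gcd ℓ' ℓ : ℝ) / Real.sqrt ((ℓ : ℝ) * ℓ')) * Real.log M| ≤ Cst * Real.log M ^ θ)) → ∀ T : ℝ, (Filter.Tendsto (fun N : ℕ => ∑ n ∈ Finset.range N, (c n - ArithmeticFunction.vonMangoldt n) / n * (Literature.NumberTheory.LFunctions.GcdForm.gcdForm (fun m => ((β m : ℝ) : ℂ)) L n).re) Filter.atTop (nhds T)) → T ≤ 1 / 2 * (Literature.NumberTheory.LFunctions.GcdForm.gcdForm (fun m => ((β m : ℝ) : ℂ)) L 1).re :=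
  fun c hc0 hU hLoc _ hC₁ _ _ hβ hL _ hb hbc hbs _ hB₀ V hV _ _ hθ hpairD _ hT =>
    typeBound_of_pairData c hc0 hU hLoc hC₁ hβ hL hb hbc hbs hB₀ V hV hθ hpairD hT

end CombType

end Summit.RiemannHypothesis.RiemannHypothesis.Theorems.SignConeConeMagnification

end
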